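import Literature.AlgebraicGeometry.Resolution.KollarNmPartBlowup
import HarnessLib

/-!
# Monomial and nonmonomial parts of `B · X` for a piece-monomial `B` (Kollár 2007, 3.110–3.111 Step 2)

Topic: `Literature/AlgebraicGeometry/Resolution`. Shared infrastructure for the decomposition of
the named fact `Kollar2007Thm3_107` (`KollarBlowupSequenceFunctors.lean`; J. Kollár, *Lectures on
Resolution of Singularities*, 2007, 3.110–3.111, pp. 176–177 of the held copy). In Step 2 of
3.111 the sequence for `N(I)^m + I^s` is a smooth blow-up sequence of order `s` for `N(I)` and
of order `m` for `I`; along it the transforms satisfy `B_r · I_r = A_r · N_r'` with piece-monomials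
`A_r`, `B_r` (`Kollar2007.Triple.IsPieceMonomial`, `KollarNmPartBlowup.lean`), and one needs
`N(I_r) = N(N_r') ⊇ N_r'` to see the level drop. This file PROVES the required piece of
Def.–Lemma 3.110: **multiplying by a piece-monomial does not change the nonmonomial part**,
`N(B·X) = N(X)` and `M(B·X) = B·M(X)`, by the uniqueness of the factorisation
(`eq_nmPart_of_factorization`), for an arbitrary ideal sheaf `X` without zero stalks on a triple
(`Kollar2007.Triple.withIdeal`):

* `monomialIdeal_map_add` (`Π P^{a+b} = Π P^a · Π P^b`), **`monomialIdeal_eq_map_expCount`**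
  (regrouping a product of powers of pairwise distinct divisors by divisor);
* `Kollar2007.Triple.withIdeal T X hX` — the triple `(X, X, E)` with another ideal; its split
  boundary, `M`, `N` are those of `T`'s boundary (`splitBoundary_withIdeal`);
* **`Kollar2007.Triple.nonmonomialPart_mul_of_isPieceMonomial`,
  `monomialPart_mul_of_isPieceMonomial`** — `N(B·X) = N(X)`, `M(B·X) = B·M(X)` for a
  piece-monomial `B` (parts with respect to the split boundary of the triple);
  `le_nonmonomialPart_of_mul_eq` — from `B·X = A·Y` with piece-monomials `A`, `B`: `Y ⊆ N(X)`.

## Sources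

* J. Kollár, *Lectures on Resolution of Singularities* (2007), Def.–Lemma 3.110 and 3.111 Step 2
  (pp. 176–177 of the held copy). [Kollar2007]
-/

noncomputable section

open CategoryTheory AlgebraicGeometry TopologicalSpace

namespace Literature.AlgebraicGeometry.Resolution

universe u

/-! ## Regrouping products of powers -/

/-- `Π_{P ∈ S} P^{a(P) + b(P)} = Π P^{a(P)} · Π P^{b(P)}`. [folklore] -/
theorem monomialIdeal_map_add {Y : Scheme.{u}} (a b : Y.IdealSheafData → ℕ) :
    ∀ S : List Y.IdealSheafData,
      monomialIdeal (S.map fun P => (P, a P + b P)) =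
        monomialIdeal (S.map fun P => (P, a P)) * monomialIdeal (S.map fun P => (P, b P))
  | [] => by simp [monomialIdeal_nil]
  | P :: S => by
    rw [List.map_cons, List.map_cons, List.map_cons, monomialIdeal_cons, monomialIdeal_cons,
      monomialIdeal_cons, monomialIdeal_map_add a b S]
    show P ^ (a P + b P) * _ = P ^ a P * _ * (P ^ b P * _)
    rw [pow_add]
    ring

/-- **Regrouping by divisor**: a product of powers of members of a list `S` of pairwise distinct
divisors equals `Π_{P ∈ S} P^{e(P)}`, `e(P)` the total exponent of `P`. [folklore] -/
theorem monomialIdeal_eq_map_expCount {Y : Scheme.{u}} (S : List Y.IdealSheafData)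
    (hS : S.Pairwise (· ≠ ·)) :
    ∀ L : List (Y.IdealSheafData × ℕ), (∀ p ∈ L, p.1 ∈ S) →
      monomialIdeal L = monomialIdeal (S.map fun P => (P, Kollar2007.Triple.expCount L P))
  | [], _ => by
    rw [monomialIdeal_nil]
    symm
    suffices h : ∀ S' : List Y.IdealSheafData,
        monomialIdeal (S'.map fun P => (P, Kollar2007.Triple.expCount ([] : List (Y.IdealSheafData × ℕ)) P)) = ⊤ from h S
    intro S'
    induction S' with
    | nil => exact monomialIdeal_nil
    | cons P S' ih =>
      rw [List.map_cons, monomialIdeal_cons, ih]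
      show P ^ (0 : ℕ) * ⊤ = ⊤
      rw [pow_zero, one_mul]
  | p :: L, hL => by
    have hp : p.1 ∈ S := hL p (List.mem_cons_self ..)
    rw [monomialIdeal_cons, monomialIdeal_eq_map_expCount S hS L fun q hq => hL q (List.mem_cons_of_mem _ hq),
      Kollar2007.Triple.monomialIdeal_map_eq_pow_mul (Kollar2007.Triple.expCount (p :: L))
        (Kollar2007.Triple.expCount L) (Kollar2007.Triple.expCount_cons_of_eq rfl L)
        (fun P hP => (Kollar2007.Triple.expCount_cons_of_ne (Ne.symm hP) L).symm) S hS hp]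

namespace Kollar2007.Triple

variable {k : Type u} [Field k] {n : ℕ}

/-! ## The triple with another ideal -/

/-- The triple `(X, X', E)` with the same scheme and boundary and another ideal `X'` without zero
stalks. [folklore] -/
def withIdeal (T : Triple k n) (X : T.X.IdealSheafData) (hX : ∀ x : T.X, stalkIdeal X x ≠ ⊥) :
    Triple k n :=
  { T with ideal := X, stalkIdeal_ne_bot := hX }

variable (T : Triple k n)

/-- Unfolding. [folklore] -/
@[simp] theorem withIdeal_ideal (X : T.X.IdealSheafData) (hX : ∀ x : T.X, stalkIdeal X x ≠ ⊥) :
    (T.withIdeal X hX).ideal = X := rfl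

/-- Unfolding. [folklore] -/
@[simp] theorem withIdeal_boundary (X : T.X.IdealSheafData) (hX : ∀ x : T.X, stalkIdeal X x ≠ ⊥) :
    (T.withIdeal X hX).boundary = T.boundary := rfl

/-- The split boundary does not see the ideal. [folklore] -/
theorem splitBoundary_withIdeal (X : T.X.IdealSheafData) (hX : ∀ x : T.X, stalkIdeal X x ≠ ⊥) :
    (T.withIdeal X hX).splitBoundary = T.splitBoundary := rfl

/-- Nor do piece-monomials. [folklore] -/
theorem isPieceMonomial_withIdeal_iff (X : T.X.IdealSheafData) (hX : ∀ x : T.X, stalkIdeal X x ≠ ⊥)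
    (A : T.X.IdealSheafData) : (T.withIdeal X hX).IsPieceMonomial A ↔ T.IsPieceMonomial A := Iff.rfl

/-- A product with a piece-monomial has no zero stalk if the other factor has none. [folklore] -/
theorem stalkIdeal_mul_ne_bot_of_isPieceMonomial {B : T.X.IdealSheafData} (hB : T.IsPieceMonomial B)
    {X : T.X.IdealSheafData} (hX : ∀ x : T.X, stalkIdeal X x ≠ ⊥) (x : T.X) :
    stalkIdeal (B * X) x ≠ ⊥ := by
  haveI := T.isRegular x
  haveI := isDomain_of_isRegularLocalRing (T.X.presheaf.stalk x)
  obtain ⟨L, hL, rfl⟩ := hB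
  rw [stalkIdeal_mul]
  refine mul_ne_zero ?_ (hX x)
  -- the stalk of a piece-monomial is nonzero (each piece has a nonzero stalk)
  suffices h : ∀ L : List (T.X.IdealSheafData × ℕ), (∀ p ∈ L, p.1 ∈ T.splitBoundary) →
      stalkIdeal (monomialIdeal L) x ≠ ⊥ from h L hL
  intro L hL
  induction L with
  | nil => rw [monomialIdeal_nil, stalkIdeal_top]; exact top_ne_bot
  | cons p L ih =>
    rw [monomialIdeal_cons, stalkIdeal_mul, stalkIdeal_pow]
    refine mul_ne_zero (pow_ne_zero _ ?_) (ih fun q hq => hL q (List.mem_cons_of_mem _ hq))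
    obtain ⟨K, hK, Z, hZ, hp⟩ := T.mem_splitBoundary_iff.mp (hL p (List.mem_cons_self ..))
    rw [← hp]
    by_cases hxZ : x ∈ (Z : Set T.X)
    · rw [T.stalkIdeal_piece_eq hK hZ hxZ]
      -- `K_x = (u)` with `u ≠ 0`
      obtain ⟨hreg, u, hu, ⟨ι, -, hιu⟩, -⟩ := T.hasSNC x
      have hxK : x ∈ K.support := componentsIn.subset (mem_boundaryPieces_iff.mp hZ) hxZ
      rw [hιu ⟨K, hK, hxK⟩]
      exact fun h => (isRsopPart_comp_of_rsop rfl u hu id Function.injective_id).ne_zero _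
        (Ideal.span_singleton_eq_bot.mp h)
    · have : x ∉ ((Scheme.IdealSheafData.vanishingIdeal Z).support : Set T.X) := by
        rwa [coe_support_vanishingIdeal]
      rw [stalkIdeal_eq_top_of_not_mem_support this]
      exact top_ne_bot

/-! ## `N(B·X) = N(X)` and `M(B·X) = B·M(X)` -/

/-- **Multiplying by a piece-monomial does not change the nonmonomial part**: for a
piece-monomial `B` and an ideal sheaf `X` without zero stalks, `N(B·X) = N(X)` (nonmonomial
parts with respect to the split boundary of the triple) — since `B·X = (B·M(X))·N(X)` with
`B·M(X)` a product of powers of pieces and `N(X)` divisible by no piece, this is the unique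
factorisation of Def.–Lemma 3.110. [cite: Kollar2007, Def.–Lemma 3.110 (p. 176)] -/
theorem nonmonomialPart_mul_of_isPieceMonomial {B : T.X.IdealSheafData} (hB : T.IsPieceMonomial B)
    (X : T.X.IdealSheafData) (hX : ∀ x : T.X, stalkIdeal X x ≠ ⊥) :
    nonmonomialPart (B * X) T.splitBoundary = nonmonomialPart X T.splitBoundary := by
  obtain ⟨L, hL, rfl⟩ := hB
  set TX := T.withIdeal X hX
  set TBX := T.withIdeal (monomialIdeal L * X) (T.stalkIdeal_mul_ne_bot_of_isPieceMonomial ⟨L, hL, rfl⟩ hX)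
  set N : T.X.IdealSheafData := nonmonomialPart X T.splitBoundary with hN
  -- `Π P^{e_B(P) + divExp X P} · N(X) = B · M(X) · N(X) = B · X`
  have hMN : monomialIdeal (T.splitBoundary.map fun P => (P, divExp X P)) * N = X := TX.mPart_mul_nmPart
  have key : monomialIdeal (T.splitBoundary.map fun P => (P, expCount L P + divExp X P)) * N =
      monomialIdeal L * X := by
    rw [monomialIdeal_map_add, ← monomialIdeal_eq_map_expCount T.splitBoundary T.splitBoundary_pairwise_ne L hL,
      mul_assoc, hMN]
  have hN' : ∀ P ∈ T.splitBoundary, ¬ N ≤ P := fun P hP => TX.not_nmPart_le_of_mem_splitBoundary hP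
  exact (TBX.eq_nmPart_of_factorization (fun P => expCount L P + divExp X P) N key hN').symm

/-- **`M(B·X) = B·M(X)`** for a piece-monomial `B` (the exponent of a piece in `B·X` is its total
exponent in `B` plus its exponent in `X`, `divExp_eq_of_factorization`).
[cite: Kollar2007, Def.–Lemma 3.110 (p. 176)] -/
theorem monomialPart_mul_of_isPieceMonomial {B : T.X.IdealSheafData} (hB : T.IsPieceMonomial B)
    (X : T.X.IdealSheafData) (hX : ∀ x : T.X, stalkIdeal X x ≠ ⊥) :
    monomialPart (B * X) T.splitBoundary = B * monomialPart X T.splitBoundary := by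
  haveI := T.isLocallyNoetherian
  obtain ⟨L, hL, rfl⟩ := hB
  set TX := T.withIdeal X hX
  set TBX := T.withIdeal (monomialIdeal L * X) (T.stalkIdeal_mul_ne_bot_of_isPieceMonomial ⟨L, hL, rfl⟩ hX)
  set N : T.X.IdealSheafData := nonmonomialPart X T.splitBoundary with hN
  have hMN : monomialIdeal (T.splitBoundary.map fun P => (P, divExp X P)) * N = X := TX.mPart_mul_nmPart
  have key : monomialIdeal (T.splitBoundary.map fun P => (P, expCount L P + divExp X P)) * N =
      monomialIdeal L * X := by
    rw [monomialIdeal_map_add, ← monomialIdeal_eq_map_expCount T.splitBoundary T.splitBoundary_pairwise_ne L hL,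
      mul_assoc, hMN]
  have hN' : ∀ P ∈ T.splitBoundary, P ≠ ⊤ → ¬ N ≤ P := fun P hP _ => TX.not_nmPart_le_of_mem_splitBoundary hP
  have hexp : ∀ P ∈ T.splitBoundary, expCount L P + divExp X P = divExp (monomialIdeal L * X) P :=
    fun P hP => divExp_eq_of_factorization TBX.hasSNC_splitBoundary TBX.splitBoundary_pairwise
      TBX.stalkIdeal_ne_bot (fun P => expCount L P + divExp X P) N key hN' hP
      (T.ne_top_of_mem_splitBoundary hP)
  -- `M(B·X) = Π P^{divExp (B·X) P} = Π P^{e_B P + divExp X P} = B · M(X)`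
  have hM : monomialPart (monomialIdeal L * X) T.splitBoundary =
      monomialIdeal (T.splitBoundary.map fun P => (P, expCount L P + divExp X P)) := by
    rw [monomialPart, monomialPartExp]
    congr 1
    exact List.map_congr_left fun P hP => by rw [hexp P hP]
  rw [hM, monomialIdeal_map_add,
    ← monomialIdeal_eq_map_expCount T.splitBoundary T.splitBoundary_pairwise_ne L hL]
  rfl

/-- **From `B·X = A·Y` with piece-monomials `A`, `B`: `Y ⊆ N(X)`** (`N(X) = N(B·X) = N(A·Y) =
N(Y) ⊇ Y`) — the form used in 3.111 Step 2 (`B_r·I_r = A_r·N_r'` gives `N_r' ⊆ N(I_r)`, hence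
`ord N(I_r) ≤ ord N_r'`). [cite: Kollar2007, 3.111 Step 2 (p. 177)] -/
theorem le_nonmonomialPart_of_mul_eq {A B X Y : T.X.IdealSheafData} (hA : T.IsPieceMonomial A)
    (hB : T.IsPieceMonomial B) (hX : ∀ x : T.X, stalkIdeal X x ≠ ⊥)
    (hY : ∀ x : T.X, stalkIdeal Y x ≠ ⊥) (h : B * X = A * Y) :
    Y ≤ nonmonomialPart X T.splitBoundary := by
  rw [← T.nonmonomialPart_mul_of_isPieceMonomial hB X hX, h, T.nonmonomialPart_mul_of_isPieceMonomial hA Y hY]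
  exact le_nonmonomialPart Y _

end Kollar2007.Triple

end Literature.AlgebraicGeometry.Resolution

end
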